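import Literature.Analysis.FluidPDE.Tao2016AveragedNS.SplitCascadeWindowLevelBound
import Literature.Analysis.FluidPDE.TaoCascadeRescaledRegime
import HarnessLib

/-!
# The split Prop. 6.5: the window level with the `n₀`-dependent profile is reproduced for `n₀` large

T. Tao, *Finite time blowup for an averaged three-dimensional Navier–Stokes equation*,
arXiv:1402.0290v3, §6.4 Prop. 6.5 (regime `… ≪ n₀`).
HONEST FRAMING: statements about the SPLIT cascade model system; nothing here proves the split
Prop. 6.5 and nothing here concerns the true Navier–Stokes equations.

One of the `n₀`-largeness facts of the assembly (seat report §7.5 (e1), §7.6): with the profile level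
`η = θ(1+ε₀)^{-n₀/4}` (`θ ≥ 0`) the window level satisfies
`windowLevel ε₀ K ε C₁ n₀ η ≤ 2√(Awin ε K)·θ·(1+ε₀)^{-n₀/4} + … ` — precisely, from
`windowLevel² ≤ Awin·η² + Bwin·(C₁δ)²` (`SplitCascadeWindowLevelBound.lean`): for every `θ > 0`,
eventually in `n₀`, `windowLevel ε₀ K ε C₁ n₀ (θ(1+ε₀)^{-n₀/4}) ≤ 2√(Awin ε K + 1)·θ·(1+ε₀)^{-n₀/4}`
(`eventually_windowLevel_le`). This is the inequality `2·windowLevel(η(1)) ≤ η(0)` etc. of the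
geometric live profile `η(0) = 4√(Awin+1)η(1)`, `η(-1) = 4√(Awin+1)η(0)`.

## References

* T. Tao, arXiv:1402.0290v3, §6.4 Prop. 6.5. [`Tao2016AveragedNS`]
-/

noncomputable section

open Filter Topology Real

namespace Literature.Analysis.FluidPDE

namespace Tao2016AveragedNS

open TaoCascade

/-- `0 ≤ Awin ε K`. [cite: Tao2016AveragedNS, §6.4 Prop. 6.5] -/
theorem Awin_nonneg (ε K : ℝ) : 0 ≤ Awin ε K := by unfold Awin; positivity

/-- `0 ≤ Bwin ε K`. [cite: Tao2016AveragedNS, §6.4 Prop. 6.5] -/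
theorem Bwin_nonneg (ε K : ℝ) : 0 ≤ Bwin ε K := by unfold Bwin; positivity

/-- **The window level of the profile `θ(1+ε₀)^{-n₀/4}` is at most `2√(Awin+1)·θ(1+ε₀)^{-n₀/4}` for
`n₀` large** (given `ε₀ > 0`, `ε > 0`, `K ≥ 0`, `θ > 0`, `C₁`). [cite: Tao2016AveragedNS, §6.4 Prop. 6.5] -/
theorem eventually_windowLevel_le {ε₀ K ε C₁ θ : ℝ} (hε₀ : 0 < ε₀) (hε : 0 < ε) (hK : 0 ≤ K)
    (hθ : 0 < θ) :
    ∀ᶠ n₀ : ℤ in atTop, windowLevel ε₀ K ε C₁ n₀ (θ * (1 + ε₀) ^ (-(n₀ : ℝ) / 4)) ≤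
      2 * Real.sqrt (Awin ε K + 1) * (θ * (1 + ε₀) ^ (-(n₀ : ℝ) / 4)) := by
  have h0 : (0 : ℝ) < 1 + ε₀ := by linarith
  -- `Bwin C₁² δ ≤ 3 θ²` eventually (`δ = (1+ε₀)^{-n₀/2} → 0`)
  have hev := eventually_mul_rpow_neg_half_le hε₀ (Bwin ε K * C₁ ^ 2) (by positivity : 0 < 3 * θ ^ 2)
  refine hev.mono fun n₀ hn₀ => ?_
  set δ : ℝ := (1 + ε₀) ^ (-(n₀ : ℝ) / 2) with hδ
  set η : ℝ := θ * (1 + ε₀) ^ (-(n₀ : ℝ) / 4) with hη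
  have hδ0 : 0 < δ := Real.rpow_pos_of_pos h0 _
  have hη0 : 0 < η := mul_pos hθ (Real.rpow_pos_of_pos h0 _)
  have hpow : ((1 + ε₀) ^ (-(n₀ : ℝ) / 4)) ^ 2 = δ := by
    rw [hδ, ← Real.rpow_natCast, ← Real.rpow_mul h0.le]; congr 1; push_cast; ring
  have hηsq : η ^ 2 = θ ^ 2 * δ := by rw [hη, mul_pow, hpow]
  have hA := Awin_nonneg ε K
  have hB := Bwin_nonneg ε K
  have hw := windowLevel_sq_le (C₁ := C₁) (n₀ := n₀) (η := η) (by linarith : (-1 : ℝ) < ε₀) hε hK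
  rw [← hδ] at hw
  -- `windowLevel² ≤ (Awin + 3) θ² δ ≤ (2√(Awin+1) η)²`
  have hsq : windowLevel ε₀ K ε C₁ n₀ η ^ 2 ≤ (2 * Real.sqrt (Awin ε K + 1) * η) ^ 2 := by
    have e1 : (2 * Real.sqrt (Awin ε K + 1) * η) ^ 2 = 4 * (Awin ε K + 1) * η ^ 2 := by
      rw [mul_pow, mul_pow, Real.sq_sqrt (by linarith)]; ring
    rw [e1, hηsq]
    have e2 : Bwin ε K * (C₁ * δ) ^ 2 = (Bwin ε K * C₁ ^ 2 * δ) * δ := by ring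
    rw [hηsq, e2] at hw
    have h3 : (Bwin ε K * C₁ ^ 2 * δ) * δ ≤ 3 * θ ^ 2 * δ := mul_le_mul_of_nonneg_right hn₀ hδ0.le
    nlinarith [hw, h3, hA, hδ0.le, sq_nonneg θ]
  have hpos : 0 ≤ 2 * Real.sqrt (Awin ε K + 1) * η := by positivity
  exact (abs_le_of_sq_le_sq' hsq hpos).2

end Tao2016AveragedNS

end Literature.Analysis.FluidPDE
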